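import Mathlib
import Summits.Ventures.PercRepro2.StepZeroOfAS3

/-!
# The abstract pinned STEP(0,2) for every increasing event, and the boundary cases of (AS3)
(seat mine-b, cell pub-perc-repro2; conjectures/MINE-B.md §12)

**Abstract pinned STEP.**  For an increasing event `A` on the subsets of a ground type `E` (a clutter:
`A X` means «`X` contains a member»), pins `O` and a split set `Y`, the two-colour counts are
`H(i,j) = #{γ ⊆ Y : pack(O ∪ (Y \ γ)) = i ∧ pack(O ∪ γ) ≥ j}` where `pack(X) ≥ k` is `kDisj A k X`
(`k` pairwise disjoint members inside `X`).  For `A = {X : X carries s to t}` this is literally the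
graph count `stepH` of `StepZeroOfAS3.lean` (`stepH_eq_absH`, by `rfl`).  The first STEP inequality
`H(0,2) ≤ H(1,1)` holds for EVERY increasing event (`absH_zero_two_le`): the Reimer row of the STEP
family is clutter-free.  (The row `(1,3)` is not: it fails on the port of the Fano matroid with pins,
MINE-B.md §12.2 — a binary Mengerian clutter.)

**(AS3) at its boundary.**  The level-refined Reimer statement `AS3 U A B` is exactly Reimer's
inequality (i) when `B` has no two disjoint witnesses on the cube (`AS3_of_no_dOcc`), and (ii) when
`A` is principal, `A = {γ : K₀ ⊆ γ}` (`AS3_of_principal`: after deleting `K₀` the statement is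
`#{B δ ∧ ¬ B (U' \ δ)} ≤ #{B δ ∧ ¬ B □ B at δ}`, i.e. `reimer_increasing` for `(B, B)`).  Together
with `A = ⊤` and `A = B` (§11.8) this locates where (AS3) is new: `A` with at least two generators
and `B` with a disjoint pair of members.
-/

open Finset

namespace Summit.Ventures.PercRepro2

namespace StepZero

open ReimerCube

variable {E : Type*} [DecidableEq E]

/-! ## The abstract pinned counts -/

/-- the pinned packing event `pack(O ∪ X) ≥ k` for an arbitrary event `A` on subsets -/
def pinK (A : Finset E → Prop) (O : Finset E) (k : ℕ) (X : Finset E) : Prop :=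
  kDisj A k (O ∪ X)

open Classical in
/-- the abstract STEP count `H(i,j) = #{γ ⊆ Y : pack(O ∪ (Y \ γ)) = i ∧ pack(O ∪ γ) ≥ j}` -/
noncomputable def absH (A : Finset E → Prop) (O Y : Finset E) (i j : ℕ) : ℕ :=
  (Y.powerset.filter (fun γ => pinK A O i (Y \ γ) ∧ ¬ pinK A O (i + 1) (Y \ γ) ∧ pinK A O j γ)).card

open Classical in
/-- the abstract joint tail `T(a,b) = #{γ ⊆ Y : pack(O ∪ (Y \ γ)) ≥ a ∧ pack(O ∪ γ) ≥ b}` -/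
noncomputable def absT (A : Finset E → Prop) (O Y : Finset E) (a b : ℕ) : ℕ :=
  (Y.powerset.filter (fun γ => pinK A O a (Y \ γ) ∧ pinK A O b γ)).card

/-- the graph count `stepH` is the abstract count for the connection event -/
theorem stepH_eq_absH {V : Type*} (ends : E → Sym2 V) (s t : V) (O Y : Finset E) (i j : ℕ) :
    stepH ends s t O Y i j = absH (fun X => Carries ends X s t) O Y i j := rfl

/-- `pinK k` is increasing for any `A` -/
lemma incr_pinK (A : Finset E → Prop) (O : Finset E) (k : ℕ) : Incr (pinK A O k) :=
  fun _ _ h hS => incr_kDisj A k (Finset.union_subset_union_right h) hS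

/-- `pinK 1` is the pinned event, for increasing `A` -/
lemma pinK_one_iff {A : Finset E → Prop} (hA : Incr A) (O X : Finset E) :
    pinK A O 1 X ↔ A (O ∪ X) :=
  kDisj_one_iff hA (O ∪ X)

/-- `pinK (k+1)` implies `pinK k` -/
lemma pinK_of_succ (A : Finset E → Prop) (O : Finset E) (k : ℕ) {X : Finset E}
    (h : pinK A O (k + 1) X) : pinK A O k X := by
  obtain ⟨_, L, _, hL, _, _, hB⟩ := h
  exact incr_kDisj A k hL (hB L le_rfl)

/-- Trimming the pins off a disjoint-occurrence witness: `k+1` disjoint members in `O ∪ γ` give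
disjoint subsets of `γ` witnessing `pinK k` and the pinned event. -/
lemma dOcc_of_pinK_succ (A : Finset E → Prop) (O : Finset E) (k : ℕ) {γ : Finset E}
    (h : pinK A O (k + 1) γ) :
    DOcc (pinK A O k) (fun X => A (O ∪ X)) γ := by
  obtain ⟨K, L, hK, hL, hKL, hA, hB⟩ := h
  refine ⟨L \ O, K \ O, ?_, ?_, ?_, ?_, ?_⟩
  · intro x hx
    rcases Finset.mem_union.mp (hL (Finset.mem_sdiff.mp hx).1) with h1 | h1
    · exact absurd h1 (Finset.mem_sdiff.mp hx).2
    · exact h1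
  · intro x hx
    rcases Finset.mem_union.mp (hK (Finset.mem_sdiff.mp hx).1) with h1 | h1
    · exact absurd h1 (Finset.mem_sdiff.mp hx).2
    · exact h1
  · exact Finset.disjoint_of_subset_left Finset.sdiff_subset
      (Finset.disjoint_of_subset_right Finset.sdiff_subset hKL.symm)
  · intro T hT
    apply hB
    intro x hx
    by_cases hxO : x ∈ O
    · exact Finset.mem_union_left _ hxO
    · exact Finset.mem_union_right _ (hT (Finset.mem_sdiff.mpr ⟨hx, hxO⟩))
  · intro T hT
    apply hA
    intro x hx
    by_cases hxO : x ∈ O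
    · exact Finset.mem_union_left _ hxO
    · exact Finset.mem_union_right _ (hT (Finset.mem_sdiff.mpr ⟨hx, hxO⟩))

/-- two disjoint members in `O ∪ ρ` give `B □ B` at `ρ` for the pinned event `B` -/
lemma dOcc_pinned_of_pinK_two {A : Finset E → Prop} (hA : Incr A) (O : Finset E) {ρ : Finset E}
    (h : pinK A O 2 ρ) :
    DOcc (fun X => A (O ∪ X)) (fun X => A (O ∪ X)) ρ := by
  have h' := dOcc_of_pinK_succ A O 1 h
  obtain ⟨K, L, hK, hL, hKL, hA1, hB⟩ := h'
  exact ⟨K, L, hK, hL, hKL, fun T hT => (pinK_one_iff hA O T).mp (hA1 T hT), hB⟩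

open Classical in
/-- the colour swap `γ ↦ Y \ γ`: `T(a,b) = T(b,a)` -/
lemma absT_swap (A : Finset E → Prop) (O Y : Finset E) (a b : ℕ) :
    absT A O Y a b = absT A O Y b a := by
  unfold absT
  apply Finset.card_nbij' (fun γ => Y \ γ) (fun γ => Y \ γ)
  · intro γ hγ
    rw [Finset.coe_filter] at hγ ⊢
    obtain ⟨hY, h1, h2⟩ := hγ
    rw [Finset.mem_powerset] at hY
    refine ⟨Finset.mem_powerset.mpr Finset.sdiff_subset, ?_, h1⟩
    rw [Finset.sdiff_sdiff_eq_self hY]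
    exact h2
  · intro γ hγ
    rw [Finset.coe_filter] at hγ ⊢
    obtain ⟨hY, h1, h2⟩ := hγ
    rw [Finset.mem_powerset] at hY
    refine ⟨Finset.mem_powerset.mpr Finset.sdiff_subset, ?_, h1⟩
    rw [Finset.sdiff_sdiff_eq_self hY]
    exact h2
  · intro γ hγ
    rw [Finset.coe_filter] at hγ
    exact Finset.sdiff_sdiff_eq_self (Finset.mem_powerset.mp hγ.1)
  · intro γ hγ
    rw [Finset.coe_filter] at hγ
    exact Finset.sdiff_sdiff_eq_self (Finset.mem_powerset.mp hγ.1)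

open Classical in
/-- `T(i,j) = T(i+1,j) + H(i,j)` -/
lemma absT_eq_add_absH (A : Finset E → Prop) (O Y : Finset E) (i j : ℕ) :
    absT A O Y i j = absT A O Y (i + 1) j + absH A O Y i j := by
  unfold absT absH
  rw [← Finset.card_filter_add_card_filter_not (fun γ => pinK A O (i + 1) (Y \ γ))
    (s := Y.powerset.filter (fun γ => pinK A O i (Y \ γ) ∧ pinK A O j γ))]
  congr 1
  · rw [Finset.filter_filter]
    congr 1
    apply Finset.filter_congr
    intro γ _
    constructor
    · rintro ⟨⟨-, hj⟩, hi1⟩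
      exact ⟨hi1, hj⟩
    · rintro ⟨hi1, hj⟩
      exact ⟨⟨pinK_of_succ A O i hi1, hj⟩, hi1⟩
  · rw [Finset.filter_filter]
    congr 1
    apply Finset.filter_congr
    intro γ _
    constructor
    · rintro ⟨⟨hi, hj⟩, hn⟩
      exact ⟨hi, hn, hj⟩
    · rintro ⟨hi, hn, hj⟩
      exact ⟨⟨hi, hj⟩, hn⟩

open Classical in
/-- **Reimer on the pinned cube: `T(0,2) ≤ T(1,1)`** for every increasing event. -/
lemma absT_zero_two_le {A : Finset E → Prop} (hA : Incr A) (O Y : Finset E) :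
    absT A O Y 0 2 ≤ absT A O Y 1 1 := by
  unfold absT
  have hB : Incr (fun X => A (O ∪ X)) :=
    fun _ _ h hS => hA (Finset.union_subset_union_right h) hS
  have h := reimer_increasing Y (fun X => A (O ∪ X)) (fun X => A (O ∪ X)) hB hB
  refine le_trans (Finset.card_le_card ?_) (le_trans h (Finset.card_le_card ?_))
  · intro γ hγ
    rw [Finset.mem_filter] at hγ ⊢
    exact ⟨hγ.1, dOcc_pinned_of_pinK_two hA O hγ.2.2⟩
  · intro γ hγ
    rw [Finset.mem_filter] at hγ ⊢
    exact ⟨hγ.1, (pinK_one_iff hA O _).mpr hγ.2.2, (pinK_one_iff hA O _).mpr hγ.2.1⟩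

/-- **The abstract pinned STEP(0,2) for every increasing event**: `H(0,2) ≤ H(1,1)`, i.e.
`#{γ ⊆ Y : pack(O ∪ (Y \ γ)) = 0 ∧ pack(O ∪ γ) ≥ 2} ≤ #{γ ⊆ Y : pack(O ∪ (Y \ γ)) = 1 ∧ pack(O ∪ γ) ≥ 1}`
— the Reimer row of the STEP family is clutter-free. -/
theorem absH_zero_two_le {A : Finset E → Prop} (hA : Incr A) (O Y : Finset E) :
    absH A O Y 0 2 ≤ absH A O Y 1 1 := by
  have h02 : absT A O Y 0 2 = absT A O Y 1 2 + absH A O Y 0 2 := absT_eq_add_absH A O Y 0 2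
  have h11 : absT A O Y 1 1 = absT A O Y 2 1 + absH A O Y 1 1 := absT_eq_add_absH A O Y 1 1
  have hsw := absT_swap A O Y 2 1
  have hR := absT_zero_two_le hA O Y
  omega

/-! ## (AS3) at its boundary: two cases that are exactly Reimer -/

open Classical in
/-- **(AS3) when `B` has no two disjoint witnesses on the cube** (`B □ B = ∅`): it is Reimer's
inequality for `(A, B)`. -/
theorem AS3_of_no_dOcc (U : Finset E) (A B : Finset E → Prop) (hA : Incr A) (hB : Incr B)
    (h : ∀ X ⊆ U, ¬ DOcc B B X) : AS3 U A B := by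
  unfold AS3
  calc (U.powerset.filter (fun γ => DOcc A B γ ∧ ¬ B (U \ γ))).card
      ≤ (U.powerset.filter (fun γ => DOcc A B γ)).card := by
        apply Finset.card_le_card
        intro γ hγ
        rw [Finset.mem_filter] at hγ ⊢
        exact ⟨hγ.1, hγ.2.1⟩
    _ ≤ (U.powerset.filter (fun γ => A γ ∧ B (U \ γ))).card := reimer_increasing U A B hA hB
    _ ≤ (U.powerset.filter (fun γ => A γ ∧ B (U \ γ) ∧ ¬ DOcc B B (U \ γ))).card := by
        apply Finset.card_le_card
        intro γ hγ
        rw [Finset.mem_filter] at hγ ⊢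
        exact ⟨hγ.1, hγ.2.1, hγ.2.2, h (U \ γ) Finset.sdiff_subset⟩

/-- disjoint occurrence with a principal first event: `K₀ ⊆ γ` and `B (γ \ K₀)` -/
lemma dOcc_principal_iff {B : Finset E → Prop} (hB : Incr B) (K₀ γ : Finset E) :
    DOcc (fun X => K₀ ⊆ X) B γ ↔ K₀ ⊆ γ ∧ B (γ \ K₀) := by
  constructor
  · rintro ⟨K, L, hK, hL, hKL, hAK, hBL⟩
    have hK0 : K₀ ⊆ K := hAK K le_rfl
    refine ⟨hK0.trans hK, ?_⟩
    apply hB _ (hBL L le_rfl)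
    intro x hx
    exact Finset.mem_sdiff.mpr ⟨hL hx, fun hx0 => Finset.disjoint_left.mp hKL (hK0 hx0) hx⟩
  · rintro ⟨hK0, hBγ⟩
    exact ⟨K₀, γ \ K₀, hK0, Finset.sdiff_subset, Finset.disjoint_sdiff, fun T hT => hT,
      fun T hT => hB hT hBγ⟩

open Classical in
/-- Reimer for `(B, B)` in the form `#{B δ ∧ ¬ B (U \ δ)} ≤ #{B δ ∧ ¬ B □ B at δ}` -/
lemma reimer_self_form (U : Finset E) (B : Finset E → Prop) (hB : Incr B) :
    (U.powerset.filter (fun δ => B δ ∧ ¬ B (U \ δ))).card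
      ≤ (U.powerset.filter (fun δ => B δ ∧ ¬ DOcc B B δ)).card := by
  have h1 := Finset.card_filter_add_card_filter_not (fun δ => B (U \ δ))
    (s := U.powerset.filter (fun δ => B δ))
  have h2 := Finset.card_filter_add_card_filter_not (fun δ => DOcc B B δ)
    (s := U.powerset.filter (fun δ => B δ))
  have hR := reimer_increasing U B B hB hB
  -- the four filtered sets, compared through subsets (instance-robust)
  have c1 : (U.powerset.filter (fun δ => B δ ∧ B (U \ δ))).card
      ≤ ((U.powerset.filter (fun δ => B δ)).filter (fun δ => B (U \ δ))).card := by
    apply Finset.card_le_card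
    intro δ hδ
    rw [Finset.mem_filter] at hδ
    rw [Finset.mem_filter, Finset.mem_filter]
    exact ⟨⟨hδ.1, hδ.2.1⟩, hδ.2.2⟩
  have c2 : (U.powerset.filter (fun δ => B δ ∧ ¬ B (U \ δ))).card
      ≤ ((U.powerset.filter (fun δ => B δ)).filter (fun δ => ¬ B (U \ δ))).card := by
    apply Finset.card_le_card
    intro δ hδ
    rw [Finset.mem_filter] at hδ
    rw [Finset.mem_filter, Finset.mem_filter]
    exact ⟨⟨hδ.1, hδ.2.1⟩, hδ.2.2⟩
  have c3 : ((U.powerset.filter (fun δ => B δ)).filter (fun δ => DOcc B B δ)).card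
      ≤ (U.powerset.filter (fun δ => DOcc B B δ)).card := by
    apply Finset.card_le_card
    intro δ hδ
    rw [Finset.mem_filter, Finset.mem_filter] at hδ
    rw [Finset.mem_filter]
    exact ⟨hδ.1.1, hδ.2⟩
  have c4 : ((U.powerset.filter (fun δ => B δ)).filter (fun δ => ¬ DOcc B B δ)).card
      ≤ (U.powerset.filter (fun δ => B δ ∧ ¬ DOcc B B δ)).card := by
    apply Finset.card_le_card
    intro δ hδ
    rw [Finset.mem_filter, Finset.mem_filter] at hδ
    rw [Finset.mem_filter]
    exact ⟨hδ.1.1, hδ.1.2, hδ.2⟩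
  omega

open Classical in
/-- **(AS3) for a principal event `A = {γ : K₀ ⊆ γ}`**, for every increasing `B`: after deleting `K₀`
it is Reimer's inequality for `(B, B)` on `U \ K₀`. -/
theorem AS3_of_principal (U K₀ : Finset E) (hK : K₀ ⊆ U) (B : Finset E → Prop) (hB : Incr B) :
    AS3 U (fun γ => K₀ ⊆ γ) B := by
  unfold AS3
  beta_reduce
  -- the left side injects into `{δ ⊆ U \ K₀ : B δ ∧ ¬ B ((U \ K₀) \ δ)}` by `γ ↦ γ \ K₀`
  have hL : (U.powerset.filter (fun γ => DOcc (fun X => K₀ ⊆ X) B γ ∧ ¬ B (U \ γ))).card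
      ≤ ((U \ K₀).powerset.filter (fun δ => B δ ∧ ¬ B ((U \ K₀) \ δ))).card := by
    apply Finset.card_le_card_of_injOn (fun γ => γ \ K₀)
    · intro γ hγ
      rw [Finset.mem_coe, Finset.mem_filter] at hγ
      obtain ⟨hU, hD, hnot⟩ := hγ
      rw [Finset.mem_powerset] at hU
      rw [dOcc_principal_iff hB] at hD
      rw [Finset.mem_coe, Finset.mem_filter, Finset.mem_powerset]
      refine ⟨Finset.sdiff_subset_sdiff hU le_rfl, hD.2, ?_⟩
      have e : (U \ K₀) \ (γ \ K₀) = U \ γ := by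
        rw [sdiff_sdiff_left, Finset.sup_eq_union, Finset.union_sdiff_of_subset hD.1]
      rw [e]
      exact hnot
    · intro γ₁ h₁ γ₂ h₂ h
      rw [Finset.mem_coe, Finset.mem_filter] at h₁ h₂
      rw [dOcc_principal_iff hB] at h₁ h₂
      have e₁ : γ₁ = (γ₁ \ K₀) ∪ K₀ := (Finset.sdiff_union_of_subset h₁.2.1.1).symm
      have e₂ : γ₂ = (γ₂ \ K₀) ∪ K₀ := (Finset.sdiff_union_of_subset h₂.2.1.1).symm
      rw [e₁, e₂]
      simp only at h
      rw [h]
  -- `{δ ⊆ U \ K₀ : B δ ∧ ¬ B □ B at δ}` injects into the right side by `δ ↦ U \ δ`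
  have hR : ((U \ K₀).powerset.filter (fun δ => B δ ∧ ¬ DOcc B B δ)).card
      ≤ (U.powerset.filter (fun γ => K₀ ⊆ γ ∧ B (U \ γ) ∧ ¬ DOcc B B (U \ γ))).card := by
    apply Finset.card_le_card_of_injOn (fun δ => U \ δ)
    · intro δ hδ
      rw [Finset.mem_coe, Finset.mem_filter, Finset.mem_powerset] at hδ
      obtain ⟨hU, hBδ, hnot⟩ := hδ
      have hδU : δ ⊆ U := hU.trans Finset.sdiff_subset
      have e : U \ (U \ δ) = δ := Finset.sdiff_sdiff_eq_self hδU
      rw [Finset.mem_coe, Finset.mem_filter, Finset.mem_powerset]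
      refine ⟨Finset.sdiff_subset, ?_, ?_, ?_⟩
      · intro x hx
        rw [Finset.mem_sdiff]
        refine ⟨hK hx, fun hxδ => ?_⟩
        have := hU hxδ
        rw [Finset.mem_sdiff] at this
        exact this.2 hx
      · rw [e]; exact hBδ
      · rw [e]; exact hnot
    · intro δ₁ h₁ δ₂ h₂ h
      rw [Finset.mem_coe, Finset.mem_filter, Finset.mem_powerset] at h₁ h₂
      have e₁ : δ₁ = U \ (U \ δ₁) := (Finset.sdiff_sdiff_eq_self (h₁.1.trans Finset.sdiff_subset)).symm
      have e₂ : δ₂ = U \ (U \ δ₂) := (Finset.sdiff_sdiff_eq_self (h₂.1.trans Finset.sdiff_subset)).symm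
      rw [e₁, e₂]
      simp only at h
      rw [h]
  -- `convert` absorbs the difference of decidability instances between `hR` and the goal
  convert le_trans hL (le_trans (reimer_self_form (U \ K₀) B hB) hR) using 4
  rfl

end StepZero

end Summit.Ventures.PercRepro2
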